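import Mathlib.MeasureTheory.Constructions.Projective
import Mathlib.MeasureTheory.Constructions.ProjectiveFamilyContent
import Mathlib.Probability.ProductMeasure
import Mathlib.Topology.MetricSpace.Polish
import HarnessLib

-- provenance: harness21/H21/H21/Prelude/Stoch/KolmogorovExtension.lean @ d967f76 (interim HEAD d8f2665); M5 mechanical rewrite
/-!
# Kolmogorov extension theorem (Stoch trunk, prelude C1)

Given an index type `ι`, a family of measurable spaces `α : ι → Type*` and a projective family
of probability measures `P J` on the finite products `∀ j : J, α j` (`J : Finset ι`), the
Kolmogorov extension theorem asserts that, when every `α i` is a Polish space with its Borel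
σ-algebra, there is a unique probability measure on `∀ i, α i` whose finite-dimensional
marginals are the `P J`.

## Mathlib anchors (used, not redefined)

* `MeasureTheory.IsProjectiveMeasureFamily`, `MeasureTheory.IsProjectiveLimit`,
  `MeasureTheory.IsProjectiveLimit.unique`, `MeasureTheory.IsProjectiveLimit.measure_cylinder`,
  `MeasureTheory.IsProjectiveLimit.isProbabilityMeasure` (file
  `Mathlib/MeasureTheory/Constructions/Projective.lean`);
* `MeasureTheory.projectiveFamilyContent` (the additive content on measurable cylinders);
* `MeasureTheory.Measure.infinitePi`, `MeasureTheory.Measure.isProjectiveLimit_infinitePi`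
  (the sorry-free special case of independent product families).

Mathlib (at the pinned commit) has no general existence theorem for projective limits; this
file provides the choice-based definition `Literature.projectiveLimit P` and states existence
(`Literature.Probability.Process.exists_isProjectiveLimit`, sorried, a known theorem) under Polish/Borel hypotheses.

## Design choices

* `hP : IsProjectiveMeasureFamily P` is an explicit hypothesis, never a type class.
* `projectiveLimit P` is defined for *every* family `P` by classical choice, with junk value `0`
  when no projective limit exists. All API lemmas assume the hypotheses of the existence theorem.
* `MeasureTheory.IsProjectiveLimit.eq_projectiveLimit` is a deliberate dot-notation extension
  declared in Mathlib's namespace `MeasureTheory.IsProjectiveLimit`; everything else lives in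
  `namespace Literature`.

## References

* A. N. Kolmogorov, *Grundbegriffe der Wahrscheinlichkeitsrechnung* (1933), Ch. III §4.
* R. Degenne, E. Marion, et al., *Formalization of Brownian motion in Lean*,
  arXiv:2511.20118 (2025) — Lean proof of the Kolmogorov extension theorem for Polish spaces.
* O. Kallenberg, *Foundations of Modern Probability* (2nd ed.), Theorem 6.16.
-/

open MeasureTheory

namespace Literature.Probability.Process

variable {ι : Type*} {α : ι → Type*} [∀ i, MeasurableSpace (α i)]

/-- The **projective limit** (Kolmogorov extension) of a family of finite-dimensional measures
`P J : Measure (∀ j : J, α j)`, `J : Finset ι`: some measure `μ` on `∀ i, α i` with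
`IsProjectiveLimit μ P` if one exists (chosen by classical choice; it is then unique by
`MeasureTheory.IsProjectiveLimit.unique` when the `P J` are finite), and the **junk value `0`**
otherwise. See Kolmogorov (1933), Ch. III §4; Kallenberg, *Foundations*, Thm 6.16. [cite: Kolmogorov1933] -/
noncomputable def projectiveLimit (P : ∀ J : Finset ι, Measure (∀ j : J, α j)) :
    Measure (∀ i, α i) :=
  open Classical in
  if h : ∃ μ, IsProjectiveLimit μ P then h.choose else 0

/-- **Kolmogorov extension theorem** (existence). A projective family of probability measures
on finite products of Polish spaces (with their Borel σ-algebras) admits a projective limit.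
Kolmogorov (1933), Ch. III §4 (for `ℝ^T`); for Polish spaces e.g. Kallenberg, *Foundations of
Modern Probability*, Thm 6.16; formalised in Lean by Degenne–Marion et al., arXiv:2511.20118. [cite: Kolmogorov1933] -/
def exists_isProjectiveLimit : Prop :=
  ∀ [∀ i, TopologicalSpace (α i)] [∀ i, PolishSpace (α i)] [∀ i, BorelSpace (α i)] {P : ∀ J : Finset ι, Measure (∀ j : J, α j)} [∀ J, IsProbabilityMeasure (P J)] (hP : IsProjectiveMeasureFamily P),
    ∃ μ : Measure (∀ i, α i), IsProjectiveLimit μ P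

/-- **Kolmogorov extension theorem** (existence and uniqueness): under the hypotheses of
`Literature.Probability.Process.exists_isProjectiveLimit` the projective limit exists and is unique. Uniqueness is
Mathlib's `MeasureTheory.IsProjectiveLimit.unique`. Kallenberg, *Foundations*, Thm 6.16. [folklore] -/
def existsUnique_isProjectiveLimit : Prop :=
  ∀ [∀ i, TopologicalSpace (α i)] [∀ i, PolishSpace (α i)] [∀ i, BorelSpace (α i)] {P : ∀ J : Finset ι, Measure (∀ j : J, α j)} [∀ J, IsProbabilityMeasure (P J)] (hP : IsProjectiveMeasureFamily P),
    ∃! μ : Measure (∀ i, α i), IsProjectiveLimit μ P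

/- interim proof relied on results that are now named facts (D-0014); demoted to a fact by the M5 import, proof preserved:
:= by
  obtain ⟨μ, hμ⟩ := exists_isProjectiveLimit hP
  exact ⟨μ, hμ, fun ν hν ↦ hν.unique hμ⟩
-/

/-- Under the hypotheses of the Kolmogorov extension theorem, `Literature.projectiveLimit P` is a
projective limit of `P`. Kallenberg, *Foundations*, Thm 6.16. [folklore] -/
def isProjectiveLimit_projectiveLimit : Prop :=
  ∀ [∀ i, TopologicalSpace (α i)] [∀ i, PolishSpace (α i)] [∀ i, BorelSpace (α i)] {P : ∀ J : Finset ι, Measure (∀ j : J, α j)} [∀ J, IsProbabilityMeasure (P J)] (hP : IsProjectiveMeasureFamily P),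
    IsProjectiveLimit (projectiveLimit P) P

/- interim proof relied on results that are now named facts (D-0014); demoted to a fact by the M5 import, proof preserved:
:= by
  have h : ∃ μ, IsProjectiveLimit μ P := exists_isProjectiveLimit hP
  rw [projectiveLimit, dif_pos h]
  exact h.choose_spec
-/

/-- The Kolmogorov extension of a projective family of probability measures is a probability
measure (Mathlib `MeasureTheory.IsProjectiveLimit.isProbabilityMeasure`).
Kallenberg, *Foundations*, Thm 6.16. [folklore] -/
def isProbabilityMeasure_projectiveLimit : Prop :=
  ∀ [∀ i, TopologicalSpace (α i)] [∀ i, PolishSpace (α i)] [∀ i, BorelSpace (α i)] {P : ∀ J : Finset ι, Measure (∀ j : J, α j)} [∀ J, IsProbabilityMeasure (P J)] (hP : IsProjectiveMeasureFamily P),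
    IsProbabilityMeasure (projectiveLimit P)

/- interim proof relied on results that are now named facts (D-0014); demoted to a fact by the M5 import, proof preserved:
:=
  (isProjectiveLimit_projectiveLimit hP).isProbabilityMeasure
-/

/-- The finite-dimensional marginal of the Kolmogorov extension on the coordinates `I` is
`P I`. Kallenberg, *Foundations*, Thm 6.16. [folklore] -/
def projectiveLimit_map_restrict : Prop :=
  ∀ [∀ i, TopologicalSpace (α i)] [∀ i, PolishSpace (α i)] [∀ i, BorelSpace (α i)] {P : ∀ J : Finset ι, Measure (∀ j : J, α j)} [∀ J, IsProbabilityMeasure (P J)] (hP : IsProjectiveMeasureFamily P) (I : Finset ι),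
    (projectiveLimit P).map I.restrict = P I

/- interim proof relied on results that are now named facts (D-0014); demoted to a fact by the M5 import, proof preserved:
:=
  isProjectiveLimit_projectiveLimit hP I
-/

/-- The Kolmogorov extension of `P` gives the cylinder `cylinder I S` the mass `P I S`
(corollary of Mathlib `MeasureTheory.IsProjectiveLimit.measure_cylinder`).
Kolmogorov (1933), Ch. III §4. [cite: Kolmogorov1933] -/
def projectiveLimit_cylinder : Prop :=
  ∀ [∀ i, TopologicalSpace (α i)] [∀ i, PolishSpace (α i)] [∀ i, BorelSpace (α i)] {P : ∀ J : Finset ι, Measure (∀ j : J, α j)} [∀ J, IsProbabilityMeasure (P J)] (hP : IsProjectiveMeasureFamily P) (I : Finset ι) {S : Set (∀ i : I, α i)} (hS : MeasurableSet S),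
    projectiveLimit P (cylinder I S) = P I S

/- interim proof relied on results that are now named facts (D-0014); demoted to a fact by the M5 import, proof preserved:
:=
  (isProjectiveLimit_projectiveLimit hP).measure_cylinder I hS
-/

/-- Sanity check: for an independent product family `J ↦ Measure.pi (fun j : J ↦ μ j)` of
probability measures, the Kolmogorov extension is Mathlib's product measure
`Measure.infinitePi μ` (by `MeasureTheory.Measure.isProjectiveLimit_infinitePi` and uniqueness).
No topological hypotheses are needed here. Kallenberg, *Foundations*, Cor. 6.18. [folklore] -/
theorem projectiveLimit_eq_infinitePi (μ : ∀ i, Measure (α i))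
    [∀ i, IsProbabilityMeasure (μ i)] :
    projectiveLimit (fun J : Finset ι ↦ Measure.pi fun j : J ↦ μ j) = Measure.infinitePi μ := by
  have h : ∃ ν, IsProjectiveLimit ν (fun J : Finset ι ↦ Measure.pi fun j : J ↦ μ j) :=
    ⟨_, Measure.isProjectiveLimit_infinitePi μ⟩
  rw [projectiveLimit, dif_pos h]
  exact h.choose_spec.unique (Measure.isProjectiveLimit_infinitePi μ)

end Literature.Probability.Process

namespace MeasureTheory.IsProjectiveLimit

variable {ι : Type*} {α : ι → Type*} [∀ i, MeasurableSpace (α i)]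

/-- Dot-notation extension, deliberately declared in Mathlib's namespace
`MeasureTheory.IsProjectiveLimit`: any projective limit `μ` of a family of finite measures `P`
equals the chosen one `Literature.projectiveLimit P` (Mathlib `IsProjectiveLimit.unique`). No
topological hypotheses are needed: existence is witnessed by `μ` itself.
Kallenberg, *Foundations*, Thm 6.16 (uniqueness part). [folklore] -/
theorem eq_projectiveLimit {P : ∀ J : Finset ι, Measure (∀ j : J, α j)}
    [∀ J, IsFiniteMeasure (P J)] {μ : Measure (∀ i, α i)} (h : IsProjectiveLimit μ P) :
    μ = Literature.Probability.Process.projectiveLimit P := by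
  have hex : ∃ ν, IsProjectiveLimit ν P := ⟨μ, h⟩
  rw [Literature.Probability.Process.projectiveLimit, dif_pos hex]
  exact h.unique hex.choose_spec

end MeasureTheory.IsProjectiveLimit
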